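import Summits.HubbardSuperconductivity.HubbardLadder.Bounds.NumberConservingGaugeFunctionBound
import HarnessLib

/-!
# Bounds node: the SYMMETRISED (reality-free) PTR gauge-function bound for number-conserving interactions

HONEST FRAMING: ladder R1–R4 with certified numbers; no claim on H/H₀. This file states BOUNDS FOR
A MODEL CLASS (no materials claim) and proves them; nothing here is a cited fact.

Cell `pub-hubbard`, unit `pub-hubbard-bounds` (gen 8 statement, gen 9 filing), `paper/bounds.tex`
Theorem 4 (first inequality, exact `1 − cos` form, symmetrised in `±u`). Companion of the landed
`Bounds/NumberConservingGaugeFunctionBound.lean` (nodes `ThermalGaugeFunctionBoundNumberConserving`,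
`GaugeFunctionBoundNumberConserving`: the ONE-SIDED PTR bounds, which need `V.map conj = V`, i.e. time
reversal). Here the reality hypothesis is DROPPED: for every Hermitian `V` with `W_φᴴ V W_φ = V` for all
site-phase gauges `W_φ = phaseGauge (x ↦ e^{iφ(x)})` (integrated `[V, n_x] = 0 ∀x`; complex exchange,
Dzyaloshinskii–Moriya, `y`-fields included) the SUM of the flux costs at `+u` and `−u` is bounded by
twice the gauge function. This symmetrised form is exactly what every stiffness ceiling of bounds.tex
Theorem 4 / 4♯ consumes (their hypotheses are two-sided in `θ`).
Setting: `Λ` any finite linearly ordered site set; `t : Λ → Λ → ℝ` symmetric (any sign / range: an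
arbitrary hopping graph; `t_{xy} = −t_b` of `bounds.tex`); `u : Λ → Λ → ℝ` antisymmetric bond phases;
`H(u) = bdgHopping (t e^{iu}) + V`, `H₀ = H(0)`; `G_φ(u) = Σ_{x,y,σ} t_{xy}(1 − cos(u_{xy} + φ_y − φ_x)) Re⟨c†_{xσ}c_{yσ}⟩`.

## Nodes (both THEOREMS, `_holds` proved below, sorry-free)

* `SymmThermalGaugeFunctionBoundNumberConserving` — ∀ β, coordinate sector `p`, `φ`:
  `2 log Z_p(H₀) + 2β G_φ(u)|_{β,p} ≤ log Z_p(H(u)) + log Z_p(H(−u))`.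
* `SymmGaugeFunctionBoundNumberConserving` — `T = 0`: ∀ `(N, S^z)` sector, unit sector ground state
  `ψ` of `H₀`, `φ`: `E(H(u)) + E(H(−u)) − 2E(H₀) ≤ −2 G_φ(u)|_ψ`.
Under the extra hypothesis `V.map conj = V` one has `Z_p(H(−u)) = Z_p(H(u))` and `E(H(−u)) = E(H(u))`
(`re_partitionFn_toBlock_bdgHopping_peierls_add_neg`, `minEnergyOn_szSector_bdgHopping_peierls_add_neg`
of the companion file), and the one-sided nodes drop out (`…_of_symm` below).
Proof route: Peierls–Bogoliubov resp. Rayleigh at `+u` in the gauge `φ` AND at `−u` in the gauge `−φ`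
(the odd paramagnetic-current terms cancel in the sum — replacing PTR's use of time reversal), the
operator midpoint identity `bdgHopping_peierls_add_peierls_neg_add`, gauge invariance of `V`, `Z_p`,
`E_{N,M}`; the hopping-part facts are those of the companion file / the Literature file at `Φ = 0`.

References: [ParamekantiTrivediRanderia1998] §II, §IV; [HazraVermaRanderia2019] eq. (2) and the
class "interactions that commute with the local density"; [KomaTasakiPRL1992] eq. (7).
-/

noncomputable section

namespace Summit.HubbardSuperconductivity.HubbardLadder.Bounds

open Matrix Finset Literature.MathematicalPhysics.QuantumLattice
  Literature.MathematicalPhysics.QuantumFieldTheory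

open scoped ComplexConjugate ComplexOrder

/-- **Node (THEOREM, proved below; SHARPENED — no reality hypothesis): symmetrised PTR gauge-function
bound at `T > 0`.** For every finite site set, symmetric real `t`, antisymmetric `u`, every Hermitian
`V` invariant under every site-phase gauge, every `β`, coordinate sector `p`, gauge function `φ`:
`2 log Z_p(H₀) + 2β Σ_{x,y,σ} t_{xy}(1 − cos(u_{xy} + φ_y − φ_x)) Re⟨(c†_{xσ}c_{yσ})|_p⟩_{β,p}
  ≤ log Z_p(H(u)) + log Z_p(H(−u))` (a bound for a model class). -/
@[conjecture] def SymmThermalGaugeFunctionBoundNumberConserving : Prop :=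
  ∀ (Λ : Type) [LinearOrder Λ] [Fintype Λ] (t u : Λ → Λ → ℝ), (∀ x y, t y x = t x y) →
    (∀ x y, u y x = -u x y) → ∀ (V : Matrix (Finset (Orb Λ)) (Finset (Orb Λ)) ℂ), V.IsHermitian →
    (∀ φ : Λ → ℝ, (phaseGauge fun x => Circle.exp (φ x))ᴴ * V * phaseGauge (fun x => Circle.exp (φ x)) = V) →
    ∀ (β : ℝ) (p : Finset (Orb Λ) → Prop) [Fintype {a // p a}] [DecidableEq {a // p a}] (φ : Λ → ℝ),
      2 * Real.log (partitionFn β ((bdgHopping (fun x y => (t x y : ℂ)) + V).toBlock p p)).re +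
          2 * (β * ∑ x : Λ, ∑ y : Λ, ∑ σ : Fin 2, t x y * (1 - Real.cos (u x y + (φ y - φ x))) *
            (gibbsState β ((bdgHopping (fun x y => (t x y : ℂ)) + V).toBlock p p)
              ((creation (orb x σ) * annihilation (orb y σ)).toBlock p p)).re) ≤
        Real.log (partitionFn β
            ((bdgHopping (fun x y => (t x y : ℂ) * Complex.exp ((u x y : ℂ) * Complex.I)) + V).toBlock p p)).re +
          Real.log (partitionFn β
            ((bdgHopping (fun x y => (t x y : ℂ) * Complex.exp (((-u x y : ℝ) : ℂ) * Complex.I)) + V).toBlock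
              p p)).re

/-- **Node (THEOREM, proved below; SHARPENED — no reality hypothesis): symmetrised PTR gauge-function
bound at `T = 0`.** Same class; for every joint sector `(N, S^z = M)`, every unit sector ground state
`ψ` of `H₀` and every `φ`: `E_{N,M}(H(u)) + E_{N,M}(H(−u)) − 2E_{N,M}(H₀)
  ≤ −2 Σ_{x,y,σ} t_{xy}(1 − cos(u_{xy} + φ_y − φ_x)) Re⟨ψ, c†_{xσ}c_{yσ}ψ⟩`. -/
@[conjecture] def SymmGaugeFunctionBoundNumberConserving : Prop :=
  ∀ (Λ : Type) [LinearOrder Λ] [Fintype Λ] (t u : Λ → Λ → ℝ), (∀ x y, t y x = t x y) →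
    (∀ x y, u y x = -u x y) → ∀ (V : Matrix (Finset (Orb Λ)) (Finset (Orb Λ)) ℂ), V.IsHermitian →
    (∀ φ : Λ → ℝ, (phaseGauge fun x => Circle.exp (φ x))ᴴ * V * phaseGauge (fun x => Circle.exp (φ x)) = V) →
    ∀ (N : ℕ) (M : ℝ) (ψ : Fock (Orb Λ)),
      IsGroundStateInSector ((bdgHopping fun x y => (t x y : ℂ)) + V) N M ψ → star ψ ⬝ᵥ ψ = 1 →
      ∀ φ : Λ → ℝ,
        ((bdgHopping fun x y => (t x y : ℂ) * Complex.exp ((u x y : ℂ) * Complex.I)) + V).minEnergyOn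
              (szSector N M) +
            ((bdgHopping fun x y => (t x y : ℂ) * Complex.exp (((-u x y : ℝ) : ℂ) * Complex.I)) + V).minEnergyOn
              (szSector N M) -
            2 * ((bdgHopping fun x y => (t x y : ℂ)) + V).minEnergyOn (szSector N M) ≤
          -(2 * ∑ x : Λ, ∑ y : Λ, ∑ σ : Fin 2, t x y * (1 - Real.cos (u x y + (φ y - φ x))) *
            (star ψ ⬝ᵥ ((creation (orb x σ) * annihilation (orb y σ)) *ᵥ ψ)).re)

section Hopping

variable {Λ : Type} [LinearOrder Λ] [Fintype Λ]

/-- **Symmetrised flux cost of the sector free energy** (Hermitian `V`, nothing else):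
`2 log Z_p(H₀) + 2β Σ t_{xy}(1 − cos u_{xy}) Re⟨(c†c)|_p⟩_{β,p} ≤ log Z_p(H(u)) + log Z_p(H(−u))`. -/
theorem two_mul_log_partitionFn_toBlock_bdgHopping_add_le {t u : Λ → Λ → ℝ}
    (ht : ∀ x y, t y x = t x y) (hu : ∀ x y, u y x = -u x y)
    {V : Matrix (Finset (Orb Λ)) (Finset (Orb Λ)) ℂ} (hV : V.IsHermitian) (β : ℝ)
    (p : Finset (Orb Λ) → Prop) [Fintype {a // p a}] [DecidableEq {a // p a}] :
    2 * Real.log (partitionFn β ((bdgHopping (fun x y => (t x y : ℂ)) + V).toBlock p p)).re +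
        2 * (β * ∑ x : Λ, ∑ y : Λ, ∑ σ : Fin 2, t x y * (1 - Real.cos (u x y)) *
          (gibbsState β ((bdgHopping (fun x y => (t x y : ℂ)) + V).toBlock p p)
            ((creation (orb x σ) * annihilation (orb y σ)).toBlock p p)).re) ≤
      Real.log (partitionFn β
          ((bdgHopping (fun x y => (t x y : ℂ) * Complex.exp ((u x y : ℂ) * Complex.I)) + V).toBlock p p)).re +
        Real.log (partitionFn β
          ((bdgHopping (fun x y => (t x y : ℂ) * Complex.exp (((-u x y : ℝ) : ℂ) * Complex.I)) + V).toBlock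
            p p)).re := by
  rcases isEmpty_or_nonempty {a // p a} with hp | hp
  · simp [partitionFn, Matrix.trace, gibbsState_apply]
  have hu' : ∀ x y, -u y x = -(-u x y) := fun x y => by rw [hu x y]
  have h0 : (bdgHopping fun x y => (t x y : ℂ)) =
      bdgHopping (fun x y => (t x y : ℂ) * Complex.exp (((0 : Λ → Λ → ℝ) x y : ℂ) * Complex.I)) := by simp
  set H₀ := (bdgHopping fun x y => (t x y : ℂ)) + V with hH₀def
  set Hp := (bdgHopping fun x y => (t x y : ℂ) * Complex.exp ((u x y : ℂ) * Complex.I)) + V with hHpdef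
  set Hm := (bdgHopping fun x y => (t x y : ℂ) * Complex.exp (((-u x y : ℝ) : ℂ) * Complex.I)) + V
    with hHmdef
  have hH₀ : H₀.IsHermitian := by
    rw [hH₀def, h0]; exact (isHermitian_bdgHopping_peierls ht (fun _ _ => by simp)).add hV
  set B₀ := H₀.toBlock p p with hB₀def
  have hB₀ : B₀.IsHermitian := hH₀.submatrix _
  have hWp : (Hp.toBlock p p - B₀).IsHermitian :=
    (((isHermitian_bdgHopping_peierls ht hu).add hV).submatrix _).sub hB₀
  have hWm : (Hm.toBlock p p - B₀).IsHermitian :=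
    (((isHermitian_bdgHopping_peierls ht hu').add hV).submatrix _).sub hB₀
  -- Peierls–Bogoliubov at the untwisted block, for `+u` and `-u`
  have hPB1 := log_partitionFn_sub_le_log_partitionFn_add hB₀ hWp β
  have hPB2 := log_partitionFn_sub_le_log_partitionFn_add hB₀ hWm β
  rw [add_sub_cancel] at hPB1 hPB2
  -- the midpoint identity, compressed to the sector and evaluated in the Gibbs state
  have hmid := bdgHopping_peierls_add_peierls_neg_add t u
  have hblock : Hp.toBlock p p - B₀ + (Hm.toBlock p p - B₀) =
      -(bdgHopping (fun x y => ((2 * (t x y * (1 - Real.cos (u x y))) : ℝ) : ℂ))).toBlock p p := by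
    ext a b
    have hab := congrFun (congrFun hmid a) b
    simp only [Matrix.add_apply, Matrix.smul_apply, smul_eq_mul] at hab
    simp only [hHpdef, hHmdef, hB₀def, hH₀def, toBlock_apply, Matrix.add_apply, Matrix.sub_apply,
      Matrix.neg_apply]
    linear_combination hab
  have hsum : (gibbsState β B₀ (Hp.toBlock p p - B₀)).re + (gibbsState β B₀ (Hm.toBlock p p - B₀)).re =
      -(2 * ∑ x : Λ, ∑ y : Λ, ∑ σ : Fin 2, t x y * (1 - Real.cos (u x y)) *
        (gibbsState β B₀ ((creation (orb x σ) * annihilation (orb y σ)).toBlock p p)).re) := by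
    rw [← Complex.add_re, ← map_add, hblock, map_neg, Complex.neg_re, re_gibbsState_toBlock_bdgHopping_real]
    simp only [Finset.mul_sum, mul_assoc]
  have hkey := congrArg (fun z : ℝ => β * z) hsum
  simp only [mul_add] at hkey
  linarith

/-- **Symmetrised flux cost of a sector ground-state energy** (Hermitian `V`, nothing else):
`E(H(u)) + E(H(−u)) − 2E(H₀) ≤ −2 Σ t_{xy}(1 − cos u_{xy}) Re⟨ψ, c†_{xσ}c_{yσ} ψ⟩`. -/
theorem minEnergyOn_szSector_bdgHopping_add_add_sub_le {t u : Λ → Λ → ℝ}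
    (ht : ∀ x y, t y x = t x y) (hu : ∀ x y, u y x = -u x y)
    {V : Matrix (Finset (Orb Λ)) (Finset (Orb Λ)) ℂ} (hV : V.IsHermitian) (N : ℕ) (M : ℝ)
    {ψ : Fock (Orb Λ)} (hgs : IsGroundStateInSector ((bdgHopping fun x y => (t x y : ℂ)) + V) N M ψ)
    (h1 : star ψ ⬝ᵥ ψ = 1) :
    ((bdgHopping fun x y => (t x y : ℂ) * Complex.exp ((u x y : ℂ) * Complex.I)) + V).minEnergyOn
            (szSector N M) +
          ((bdgHopping fun x y => (t x y : ℂ) * Complex.exp (((-u x y : ℝ) : ℂ) * Complex.I)) + V).minEnergyOn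
            (szSector N M) -
        2 * ((bdgHopping fun x y => (t x y : ℂ)) + V).minEnergyOn (szSector N M) ≤
      -(2 * ∑ x : Λ, ∑ y : Λ, ∑ σ : Fin 2, t x y * (1 - Real.cos (u x y)) *
        (star ψ ⬝ᵥ ((creation (orb x σ) * annihilation (orb y σ)) *ᵥ ψ)).re) := by
  have hu' : ∀ x y, -u y x = -(-u x y) := fun x y => by rw [hu x y]
  have hsplit : ∀ τ : Λ → Λ → ℂ, (star ψ ⬝ᵥ ((bdgHopping τ + V) *ᵥ ψ)).re =
      (star ψ ⬝ᵥ (bdgHopping τ *ᵥ ψ)).re + (star ψ ⬝ᵥ (V *ᵥ ψ)).re := by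
    intro τ
    rw [add_mulVec, dotProduct_add, Complex.add_re]
  have hp := minEnergyOn_le_rayleigh_of_mem ((isHermitian_bdgHopping_peierls ht hu).add hV) _ hgs.1 h1
  have hm := minEnergyOn_le_rayleigh_of_mem ((isHermitian_bdgHopping_peierls ht hu').add hV) _ hgs.1 h1
  rw [hsplit] at hp hm
  have hE : (star ψ ⬝ᵥ (bdgHopping (fun x y => (t x y : ℂ)) *ᵥ ψ)).re + (star ψ ⬝ᵥ (V *ᵥ ψ)).re =
      ((bdgHopping fun x y => (t x y : ℂ)) + V).minEnergyOn (szSector N M) := by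
    rw [← hsplit, hgs.2.2, dotProduct_smul, h1, smul_eq_mul, mul_one, Complex.ofReal_re]
  have hmid := congrArg (fun A : Matrix (Finset (Orb Λ)) (Finset (Orb Λ)) ℂ => (star ψ ⬝ᵥ (A *ᵥ ψ)).re)
    (bdgHopping_peierls_add_peierls_neg_add t u)
  simp only [add_mulVec, dotProduct_add, Complex.add_re, smul_mulVec, dotProduct_smul, smul_eq_mul,
    re_star_dotProduct_bdgHopping_real_mulVec] at hmid
  have h2re : ((2 : ℂ) * (star ψ ⬝ᵥ (bdgHopping (fun x y => (t x y : ℂ)) *ᵥ ψ))).re =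
      2 * (star ψ ⬝ᵥ (bdgHopping (fun x y => (t x y : ℂ)) *ᵥ ψ)).re := by
    simp [Complex.mul_re]
  have hS : ∑ x : Λ, ∑ y : Λ, ∑ σ : Fin 2, 2 * (t x y * (1 - Real.cos (u x y))) *
        (star ψ ⬝ᵥ ((creation (orb x σ) * annihilation (orb y σ)) *ᵥ ψ)).re =
      2 * ∑ x : Λ, ∑ y : Λ, ∑ σ : Fin 2, t x y * (1 - Real.cos (u x y)) *
        (star ψ ⬝ᵥ ((creation (orb x σ) * annihilation (orb y σ)) *ᵥ ψ)).re := by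
    simp only [Finset.mul_sum, mul_assoc]
  rw [h2re, hS] at hmid
  linarith

/-- Gauge covariance `W_{±φ}ᴴ H(±u) W_{±φ} = H(±(u + dφ))` for a gauge-invariant `V`
(`s = 1`: `+`, `s = -1`: `−`; stated with a real sign to serve both at once). -/
theorem conjTranspose_phaseGauge_mul_bdgHopping_add_mul_phaseGauge (t u : Λ → Λ → ℝ)
    {V : Matrix (Finset (Orb Λ)) (Finset (Orb Λ)) ℂ}
    (hVg : ∀ φ : Λ → ℝ,
      (phaseGauge fun x => Circle.exp (φ x))ᴴ * V * phaseGauge (fun x => Circle.exp (φ x)) = V)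
    (φ : Λ → ℝ) (s : ℝ) :
    (phaseGauge fun x => Circle.exp (s * φ x))ᴴ *
        ((bdgHopping fun x y => (t x y : ℂ) * Complex.exp (((s * u x y : ℝ) : ℂ) * Complex.I)) + V) *
        phaseGauge (fun x => Circle.exp (s * φ x)) =
      (bdgHopping fun x y =>
          (t x y : ℂ) * Complex.exp (((s * (u x y + (φ y - φ x)) : ℝ) : ℂ) * Complex.I)) + V := by
  rw [Matrix.mul_add, Matrix.add_mul,
    conjTranspose_phaseGauge_mul_bdgHopping_peierls_mul_phaseGauge t (fun x y => s * u x y) (fun x => s * φ x),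
    hVg]
  congr 1
  refine congrArg bdgHopping (funext fun x => funext fun y => ?_)
  rw [show (s * u x y + (s * φ y - s * φ x) : ℝ) = s * (u x y + (φ y - φ x)) by ring]

end Hopping

/-- `SymmThermalGaugeFunctionBoundNumberConserving` holds (Peierls–Bogoliubov at `+(u + dφ)` in the
gauge `φ` and at `−(u + dφ)` in the gauge `−φ`, gauge invariance of the sector partition functions,
midpoint identity). -/
theorem symmThermalGaugeFunctionBoundNumberConserving_holds :
    SymmThermalGaugeFunctionBoundNumberConserving := by
  intro Λ _ _ t u ht hu V hV hVg β p _ _ φ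
  have hu' : ∀ x y, u y x + (φ x - φ y) = -(u x y + (φ y - φ x)) := fun x y => by rw [hu x y]; ring
  have h := two_mul_log_partitionFn_toBlock_bdgHopping_add_le (u := fun x y => u x y + (φ y - φ x))
    ht hu' hV β p
  have hp := conjTranspose_phaseGauge_mul_bdgHopping_add_mul_phaseGauge t u hVg φ 1
  have hm := conjTranspose_phaseGauge_mul_bdgHopping_add_mul_phaseGauge t u hVg φ (-1)
  simp only [one_mul] at hp
  simp only [neg_mul, one_mul] at hm
  rw [← hp, ← hm, partitionFn_toBlock_conjTranspose_phaseGauge_mul_mul_phaseGauge,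
    partitionFn_toBlock_conjTranspose_phaseGauge_mul_mul_phaseGauge] at h
  exact h

/-- `SymmGaugeFunctionBoundNumberConserving` holds (Rayleigh with the ground state gauged by `±φ`,
gauge invariance of the sector energies, midpoint identity). -/
theorem symmGaugeFunctionBoundNumberConserving_holds : SymmGaugeFunctionBoundNumberConserving := by
  intro Λ _ _ t u ht hu V hV hVg N M ψ hgs h1 φ
  have hu' : ∀ x y, u y x + (φ x - φ y) = -(u x y + (φ y - φ x)) := fun x y => by rw [hu x y]; ring
  have h := minEnergyOn_szSector_bdgHopping_add_add_sub_le (u := fun x y => u x y + (φ y - φ x))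
    ht hu' hV N M hgs h1
  have hp := conjTranspose_phaseGauge_mul_bdgHopping_add_mul_phaseGauge t u hVg φ 1
  have hm := conjTranspose_phaseGauge_mul_bdgHopping_add_mul_phaseGauge t u hVg φ (-1)
  simp only [one_mul] at hp
  simp only [neg_mul, one_mul] at hm
  rw [← hp, ← hm, minEnergyOn_szSector_phaseGauge_conj, minEnergyOn_szSector_phaseGauge_conj] at h
  exact h

/-- The one-sided thermal node follows from the symmetrised one under reality of `V` (time reversal);
an alternative proof of the companion file's `thermalGaugeFunctionBoundNumberConserving_holds`. -/
theorem thermalGaugeFunctionBoundNumberConserving_of_symm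
    (h : SymmThermalGaugeFunctionBoundNumberConserving) : ThermalGaugeFunctionBoundNumberConserving := by
  intro Λ _ _ t u ht hu V hV hVc hVg β p _ _ φ
  have h' := h Λ t u ht hu V hV hVg β p φ
  rw [re_partitionFn_toBlock_bdgHopping_peierls_add_neg t u hVc] at h'
  linarith

/-- The one-sided `T = 0` node follows from the symmetrised one under reality of `V`. -/
theorem gaugeFunctionBoundNumberConserving_of_symm (h : SymmGaugeFunctionBoundNumberConserving) :
    GaugeFunctionBoundNumberConserving := by
  intro Λ _ _ t u ht hu V hV hVc hVg N M ψ hgs h1 φ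
  have h' := h Λ t u ht hu V hV hVg N M ψ hgs h1 φ
  rw [minEnergyOn_szSector_bdgHopping_peierls_add_neg t u hVc] at h'
  linarith

end Summit.HubbardSuperconductivity.HubbardLadder.Bounds

end
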